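import Summits.ResolutionOfSingularities.ResolutionOfSingularities.Theorems.WeightedInvariantIota3IdealDescentOfInvariance
import Literature.AlgebraicGeometry.Resolution.SmoothUniformizationProofs
import Literature.AlgebraicGeometry.Resolution.RegularLocalRingsProofs
import Mathlib.RingTheory.LocalProperties.Reduced
import Mathlib.RingTheory.Ideal.Quotient.Nilpotent
import HarnessLib

/-!
# (RAD)₃ DISCHARGED: the fibre ideal `𝔪'·(T' ⊗_T T')` of a formally smooth e.f.t. algebra of a local ring is radical; the gap list of
# `stub_keyRungGrHomLE_three` with (IDLexact)₃ replaced by (INV)₃ alone (door `HypersurfaceCentreConstruction`, stmt-ResolutionOfSingularities-19897)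

Helper for `stub_keyRungGrHomLE_three` (def-free, `--supports 19897`).  Sequel of …Iota3IdealDescentOfInvariance, whose gap list
`keyRungGrHomLE_three_of_invariance5` carries (RAD)₃ «the fibre ideal `p₁(𝔪')·(T' ⊗_T T')` is radical».  PROVED here for EVERY formally smooth
essentially-of-finite-type algebra `T → T'` with `T'` local (`isRadical_map_maximalIdeal_tensor`): `(T' ⊗_T T')/p₁(𝔪')(T' ⊗_T T') ≅ (T' ⊗_T T') ⊗_{T'} κ'`
is formally smooth and essentially of finite type over the residue FIELD `κ' = T'/𝔪'`, and such an algebra is reduced because its local rings are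
regular (`Literature…isRegularLocalRing_of_formallySmooth_of_essFiniteType`, Görtz–Wedhorn 6.26; reducedness is local, Mathlib
`isReduced_ofLocalizationMaximal`).  GAP LIST OF RECORD after this file: **`keyRungGrHomLE_three_of_invariance4`** — hypotheses hD (desc-τ as typed;
door-proved), **(INV)₃** (invariance of the two levels of exactly ratio-maximal two-flags at one regular local ring of dimension three — the content
of the dominance word), hgame, hres.  [OURS · L1 W4.3 · audit glue; AI work, weaker than expert review; nothing here is a statement of the manuscript
under review.]
-/

noncomputable section

open IsLocalRing Literature.AlgebraicGeometry.Resolution TensorProduct Algebra.TensorProduct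
open Summit.ResolutionOfSingularities.ResolutionOfSingularities.Theorems

set_option linter.dupNamespace false -- mandated namespace of this single-conjunct summit

namespace Summit.ResolutionOfSingularities.ResolutionOfSingularities.Cruxes.HypersurfaceCentreConstruction.LocalEngine

namespace FibreDescent

/-- **A formally smooth, essentially of finite type algebra over a field is reduced** (its local rings are regular, hence domains;
reducedness is a local property). [cite: GortzWedhorn2020, Lemma 6.26 (p. 196)] -/
theorem isReduced_of_formallySmooth_of_essFiniteType_field (K D : Type) [Field K] [CommRing D] [Algebra K D]
    [Algebra.EssFiniteType K D] [Algebra.FormallySmooth K D] : IsReduced D := by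
  refine isReduced_ofLocalizationMaximal D fun J hJ => ?_
  haveI : Algebra.FormallySmooth D (Localization.AtPrime J) := Algebra.FormallySmooth.of_isLocalization J.primeCompl
  haveI : Algebra.FormallySmooth K (Localization.AtPrime J) := Algebra.FormallySmooth.comp K D (Localization.AtPrime J)
  haveI : IsRegularLocalRing (Localization.AtPrime J) :=
    isRegularLocalRing_of_formallySmooth_of_essFiniteType K (Localization.AtPrime J)
  haveI : IsDomain (Localization.AtPrime J) := isDomain_of_isRegularLocalRing (Localization.AtPrime J)
  show IsReduced (Localization.AtPrime J)
  infer_instance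

/-- **(RAD) — the fibre ideal `p₁(𝔪')·(T' ⊗_T T')` is radical** for `T → T'` formally smooth and essentially of finite type with `T'` local:
the quotient is `(T' ⊗_T T') ⊗_{T'} κ(T')`, formally smooth and essentially of finite type over the residue field, hence reduced.
[cite: GortzWedhorn2020, Lemma 6.26 (p. 196)] -/
theorem isRadical_map_maximalIdeal_tensor (T T' : Type) [CommRing T] [CommRing T'] [Algebra T T'] [IsLocalRing T']
    [Algebra.FormallySmooth T T'] [Algebra.EssFiniteType T T'] :
    ((maximalIdeal T').map (algebraMap T' (T' ⊗[T] T'))).IsRadical := by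
  rw [Ideal.isRadical_iff_quotient_reduced]
  letI : Field (T' ⧸ maximalIdeal T') := Ideal.Quotient.field (maximalIdeal T')
  -- `κ' ⊗_{T'} C` is reduced
  haveI : IsReduced ((T' ⧸ maximalIdeal T') ⊗[T'] (T' ⊗[T] T')) :=
    isReduced_of_formallySmooth_of_essFiniteType_field (T' ⧸ maximalIdeal T') _
  -- transport along `C/𝔪'C ≅ C ⊗_{T'} κ' ≅ κ' ⊗_{T'} C`
  let e := (Algebra.TensorProduct.quotIdealMapEquivTensorQuot (T' ⊗[T] T') (maximalIdeal T')).toRingEquiv.trans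
    (Algebra.TensorProduct.comm T' (T' ⊗[T] T') (T' ⧸ maximalIdeal T')).toRingEquiv
  exact isReduced_of_injective e e.injective

end FibreDescent

open Iota3 in
/-- **GAP LIST OF RECORD for `stub_keyRungGrHomLE_three` — (IDLexact)₃ replaced by (INV)₃ alone**: hypotheses hD (desc-τ as typed; door-proved
`Iota3.isTiePosition_descent_door`), **(INV)₃** «in a regular local ring of dimension three, two two-flags carrying `g ∈ 𝔪 ∖ 0` to level `r₁ν` of
the same admissible `(q; r₁, r₂)`, `q < r₂`, exactly ratio-maximal for `g`, have comparable levels `r₁` and `r₂`», hgame, hres (the residue of the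
dominance word at the power positions). [OURS · L1 W4.3 · audit glue] -/
theorem keyRungGrHomLE_three_of_invariance4 (p : ℕ)
    (hD : ∀ (T T' : Type) [CommRing T] [IsRegularLocalRing T] [CommRing T'] [IsRegularLocalRing T'] [Algebra T T']
      [IsLocalHom (algebraMap T T')] [Algebra.FormallySmooth T T'] [Algebra.EssFiniteType T T'] (g : T),
      ringKrullDim T' ≤ 3 → IsTiePosition T' (algebraMap T T' g) → IsTiePosition T g)
    (hINV : ∀ (A : Type) [CommRing A] [IsRegularLocalRing A] (g : A), ringKrullDim A = (3 : ℕ) → g ≠ 0 → g ∈ maximalIdeal A →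
      ∀ (g₁ g₂ g₁' g₂' : A) (q r₁ r₂ : ℕ), IsTwoFlag g₁ g₂ → IsTwoFlag g₁' g₂' → AdmissibleTriple q r₁ r₂ → q < r₂ →
      g ∈ flagContactFiltration g₁ g₂ q r₁ r₂ (r₁ * (adicOrder g).toNat) →
      g ∈ flagContactFiltration g₁' g₂' q r₁ r₂ (r₁ * (adicOrder g).toNat) →
      (∀ q' r₁' r₂' : ℕ, AdmissibleTriple q' r₁' r₂' → FlagReaches g (adicOrder g).toNat q' r₁' r₂' → r₁' * r₂ ≤ r₁ * r₂') →
      flagContactFiltration g₁' g₂' q r₁ r₂ r₁ ≤ flagContactFiltration g₁ g₂ q r₁ r₂ r₁ ∧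
        flagContactFiltration g₁' g₂' q r₁ r₂ r₂ ≤ flagContactFiltration g₁ g₂ q r₁ r₂ r₂)
    (hgame : CanonicalGameClauseHomLE 3 p iotaFlatT jFlatT)
    (hres : ∀ (k₀ : Type) [Field k₀] [CharP k₀ p] [PerfectField k₀]
      (S : Type) [CommRing S] [Algebra k₀ S] [Algebra.EssFiniteType k₀ S] [IsRegularLocalRing S] (f : S),
      ringKrullDim S = (3 : ℕ) → f ≠ 0 → f ∈ (maximalIdeal S) ^ 2 →
      ContactCylinder.topStratumPrime iotaOrdEpsTau S f = maximalIdeal S → iotaEps S f ≠ 1 →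
      (∃ ℓ ∈ maximalIdeal S, f ∈ Ideal.span {ℓ ^ (adicOrder f).toNat} ⊔ maximalIdeal S ^ ((adicOrder f).toNat + 1)) →
      ∀ (a b : ℕ), 0 < b →
      (∀ q' r₁' r₂' : ℕ, AdmissibleTriple q' r₁' r₂' → FlagReaches f (adicOrder f).toNat q' r₁' r₂' → r₁' * b ≤ a * r₂') →
      ∀ (g₁ g₂ g₁' g₂' : S) (q r₁ r₂ : ℕ), AdmissibleTriple q r₁ r₂ → r₁ * b = a * r₂ → q < r₂ → r₂ < r₁ →
        IsTwoFlag g₁ g₂ → IsTwoFlag g₁' g₂' →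
        f ∈ flagContactFiltration g₁ g₂ q r₁ r₂ (r₁ * (adicOrder f).toNat) →
        f ∈ flagContactFiltration g₁' g₂' q r₁ r₂ (r₁ * (adicOrder f).toNat) →
        g₂' ∈ flagContactFiltration g₁ g₂ q r₁ r₂ r₂) :
    KeyRungGrHomLE 3 p :=
  keyRungGrHomLE_three_of_invariance5 p hD hINV
    (fun T T' _ _ _ _ _ _ _ _ _ _ _ => FibreDescent.isRadical_map_maximalIdeal_tensor T T') hgame hres

end Summit.ResolutionOfSingularities.ResolutionOfSingularities.Cruxes.HypersurfaceCentreConstruction.LocalEngine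

end
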